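import Mathlib

/-!
# `E^× = 𝒪_E^× · ϖ^ℤ`, and `G/F ≅ U/(U ∩ F)` when `G = U·F`
(kernel witness for the inflation step of the standard fact (A10) of the Tier-5 [A]-ledger:
«a character of `U_E/U_E^a U_{F_v}` … inflates to `E_v^×/F_v^× = U_E F_v^×/F_v^× ≅ U_E/U_{F_v}`»)

* `exists_unit_mul_zpow` — for a discrete valuation ring `S` with uniformiser `ϖ` and fraction
  field `L`, every `x ∈ L^×` is `u · ϖ^k` with `u ∈ Sˣ`, `k ∈ ℤ`;
* `unitsRange_sup_zpowers_eq_top` — as subgroups of `Lˣ`: `(image of Sˣ) ⊔ ⟨ϖ⟩ = ⊤`;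
* `quotientEquivOfSupEqTop` — **second isomorphism theorem in the form used**: for subgroups
  `U, F` of a commutative group `G` with `U ⊔ F = ⊤`, `U/(U ∩ F) ≃ G/F`;
* `quotientEquiv_of_le_sup` — the same when `F` contains a subgroup `P` with `U ⊔ P = ⊤`
  (`P = ⟨ϖ⟩ ≤ F_v^×` at an inert place: `E_v^×/F_v^× ≅ 𝒪_E^×/(𝒪_E^× ∩ F_v^×) = U_E/U_F`).

Not modelled: the subfield `F_v` itself (the hypothesis `⟨ϖ⟩ ≤ F` is the prose «π_F is a uniformiser
of `E_v` at an inert place»).  Mathlib-only; axioms standard.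
Uses an L-value-free non-vanishing device: NO (README §8(d)).
-/

namespace Summit.Ventures.HodgeRepro2.T5LocalFieldUnitsDecomposition

section Group

variable {G : Type*} [CommGroup G]

/-- The composite `U → G → G/F` is surjective when `U ⊔ F = ⊤`. -/
theorem surjective_mk_comp_subtype (U F : Subgroup G) (h : U ⊔ F = ⊤) :
    Function.Surjective ((QuotientGroup.mk' F).comp U.subtype) := by
  intro y
  obtain ⟨g, rfl⟩ := QuotientGroup.mk_surjective y
  have hg : g ∈ U ⊔ F := by rw [h]; exact Subgroup.mem_top g
  obtain ⟨u, hu, f, hf, rfl⟩ := Subgroup.mem_sup.mp hg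
  refine ⟨⟨u, hu⟩, ?_⟩
  simp only [MonoidHom.coe_comp, Function.comp_apply, Subgroup.coe_subtype,
    QuotientGroup.mk'_apply]
  rw [QuotientGroup.eq]
  simpa using F.inv_mem hf

/-- The kernel of `U → G/F` is `U ∩ F` (as a subgroup of `U`). -/
theorem ker_mk_comp_subtype (U F : Subgroup G) :
    ((QuotientGroup.mk' F).comp U.subtype).ker = F.subgroupOf U := by
  ext u
  simp [MonoidHom.mem_ker, Subgroup.mem_subgroupOf, QuotientGroup.eq_one_iff]

/-- **`U/(U ∩ F) ≃ G/F` when `U ⊔ F = ⊤`** (second isomorphism theorem). -/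
noncomputable def quotientEquivOfSupEqTop (U F : Subgroup G) (h : U ⊔ F = ⊤) :
    U ⧸ F.subgroupOf U ≃* G ⧸ F :=
  (QuotientGroup.quotientMulEquivOfEq (ker_mk_comp_subtype U F).symm).trans
    (QuotientGroup.quotientKerEquivOfSurjective _ (surjective_mk_comp_subtype U F h))

/-- If `U ⊔ P = ⊤` and `P ≤ F`, then `U ⊔ F = ⊤` and `U/(U ∩ F) ≃ G/F`. -/
noncomputable def quotientEquiv_of_le_sup (U P F : Subgroup G) (h : U ⊔ P = ⊤) (hPF : P ≤ F) :
    U ⧸ F.subgroupOf U ≃* G ⧸ F :=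
  quotientEquivOfSupEqTop U F (top_le_iff.mp (h ▸ sup_le_sup_left hPF U))

end Group

section DVR

variable {S L : Type*} [CommRing S] [IsDomain S] [IsDiscreteValuationRing S] [Field L]
  [Algebra S L] [IsFractionRing S L] (ϖ : S)

/-- Every non-zero element of the fraction field of a discrete valuation ring is
`u · ϖ^k` with `u` a unit of `S` and `k ∈ ℤ`. -/
theorem exists_unit_mul_zpow (hϖ : Irreducible ϖ) (x : L) (hx : x ≠ 0) :
    ∃ (u : Sˣ) (k : ℤ), x = algebraMap S L (u : S) * algebraMap S L ϖ ^ k := by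
  obtain ⟨a, b, hb, rfl⟩ := IsFractionRing.div_surjective S x
  have hb0 : b ≠ 0 := nonZeroDivisors.ne_zero hb
  have ha0 : a ≠ 0 := by
    rintro rfl
    simp at hx
  obtain ⟨m, u, hu⟩ := IsDiscreteValuationRing.eq_unit_mul_pow_irreducible ha0 hϖ
  obtain ⟨n, v, hv⟩ := IsDiscreteValuationRing.eq_unit_mul_pow_irreducible hb0 hϖ
  have hϖL : algebraMap S L ϖ ≠ 0 := by
    rw [ne_eq, IsFractionRing.to_map_eq_zero_iff]
    exact hϖ.ne_zero
  refine ⟨u * v⁻¹, (m : ℤ) - n, ?_⟩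
  rw [hu, hv, map_mul, map_mul, map_pow, map_pow, Units.val_mul, map_mul, zpow_sub₀ hϖL,
    zpow_natCast, zpow_natCast]
  have hv' : algebraMap S L ((v⁻¹ : Sˣ) : S) = (algebraMap S L (v : S))⁻¹ :=
    eq_inv_of_mul_eq_one_left (by rw [← map_mul, Units.inv_mul, map_one])
  rw [hv']
  have hvL : algebraMap S L (v : S) ≠ 0 := by
    rw [ne_eq, IsFractionRing.to_map_eq_zero_iff]
    exact v.ne_zero
  field_simp

/-- `ϖ` as a unit of `L`. -/
noncomputable def uniformizerUnit (hϖ : Irreducible ϖ) : Lˣ :=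
  Units.mk0 (algebraMap S L ϖ) (by
    rw [ne_eq, IsFractionRing.to_map_eq_zero_iff]
    exact hϖ.ne_zero)

/-- **`L^× = (image of Sˣ) · ϖ^ℤ`** as subgroups of `Lˣ`. -/
theorem unitsRange_sup_zpowers_eq_top (hϖ : Irreducible ϖ) :
    (Units.map (algebraMap S L).toMonoidHom).range ⊔
      Subgroup.zpowers (uniformizerUnit (L := L) ϖ hϖ) = ⊤ := by
  rw [eq_top_iff]
  intro x _
  obtain ⟨u, k, hx⟩ := exists_unit_mul_zpow ϖ hϖ (x : L) x.ne_zero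
  have : x = Units.map (algebraMap S L).toMonoidHom u * uniformizerUnit (L := L) ϖ hϖ ^ k := by
    apply Units.ext
    rw [Units.val_mul, Units.val_zpow_eq_zpow_val, Units.coe_map]
    exact hx
  rw [this]
  exact Subgroup.mul_mem_sup ⟨u, rfl⟩ (Subgroup.mem_zpowers_iff.mpr ⟨k, rfl⟩)

/-- **The inflation isomorphism**: for any subgroup `F ≤ Lˣ` containing `ϖ`,
`(image of Sˣ)/(image ∩ F) ≃ Lˣ/F` — with `F = F_v^×` at an inert place of `E/F`:
`E_v^×/F_v^× ≅ 𝒪_E^×/(𝒪_E^× ∩ F_v^×) = U_E/U_F`. -/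
noncomputable def quotientEquivOfUniformizerMem (hϖ : Irreducible ϖ) (F : Subgroup Lˣ)
    (hF : uniformizerUnit (L := L) ϖ hϖ ∈ F) :
    (Units.map (algebraMap S L).toMonoidHom).range ⧸
        F.subgroupOf (Units.map (algebraMap S L).toMonoidHom).range ≃* Lˣ ⧸ F :=
  quotientEquiv_of_le_sup _ _ F (unitsRange_sup_zpowers_eq_top ϖ hϖ)
    (Subgroup.zpowers_le.mpr hF)

end DVR

end Summit.Ventures.HodgeRepro2.T5LocalFieldUnitsDecomposition
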